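import Mathlib
import HarnessLib

/-!
# T28-C storey (B2), zoom lemmas III: the log-mean hypothesis (LM_q) passes to the `liminf` rate of the zooms
# — parabolic change of variables (scale invariance of log-windows) + Fatou
# (item `TerminalTrace.TypeITraceScarL3`, stmt-NavierStokesRegularity-18385, Stub LOUD line; helpers)

Seat nsreg-C26-p1 g2 (cell ns-regularity-ideate), `--supports stmt-NavierStokesRegularity-18385` (helper);
ROUND-28 §3 T28-C (nsreg-p2 g29: «(LM_q) is scale-invariant (log-windows map to log-windows, the slack K₀ is
additive and survives), and passes to blow-up limits by … Fatou in τ»), DIRECTOR-NS #130 (2).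

* `setLIntegral_Ioo_comp_mul_left` — `∫⁻_{]s',s[} g(cσ) dσ = c⁻¹ · ∫⁻_{]cs', cs[} g` for `c > 0`.
* `setLIntegral_sq_zoomRate_le` — ONE zoom: if `∫⁻_{]t',t[} b² ≤ ofReal(2q·log((−t')/(−t)) + K₀)` for
  `−δ₁ < t' ≤ t < 0`, then the zoomed rate `σ ↦ c·b(c²σ)` obeys the SAME bound on every window
  `]s',s[` with `−δ₁/c² < s' ≤ s < 0`:  `∫⁻_{]s',s[} ofReal(c·b(c²σ))² ≤ ofReal(2q·log((−s')/(−s)) + K₀)`.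
* **`setLIntegral_liminfRate_sq_le`** — along scales `λ_k → 0⁺` the `liminf` rate
  `β_∞(σ) = liminf_k ofReal(λ_k·b(λ_k²σ))` obeys `∫⁻_{]s',s[} β_∞² ≤ ofReal(2q·log((−s')/(−s)) + K₀)` for ALL
  `s' ≤ s < 0` (Fatou `lintegral_liminf_le'`; `b` measurable).  Together with `ae_liminfRate_of_zoomLimit_of_ball`
  (`…LogMeanZoomRate`) this is exactly the pair of hypotheses of `one_le_logMean_of_quietShell_of_aeRate` /
  `no_topSingular_of_aeLogMean_lt_one` (`…LogMeanApexAECloser/AEConsequences`) for the zoom limit.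

WHAT THIS IS NOT: not the zoom-data package itself (the re-run of `exists_extinctApex_zoomData_unit_const`
carrying `b`), not NS regularity. [folklore]
-/

noncomputable section

set_option linter.dupNamespace false

namespace Summit.NavierStokesRegularity.NavierStokesRegularity.Theorems.TypeITraceScarL3

open MeasureTheory Set Function Filter Topology
open scoped NNReal ENNReal

/-- Linear change of variables in a `lintegral` over an open interval: `∫⁻_{]s',s[} g(cσ) dσ =
c⁻¹ ∫⁻_{]cs', cs[} g` (`c > 0`). [folklore] -/
theorem setLIntegral_Ioo_comp_mul_left (g : ℝ → ℝ≥0∞) {c : ℝ} (hc : 0 < c) (s' s : ℝ) :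
    ∫⁻ σ in Ioo s' s, g (c * σ) = ENNReal.ofReal c⁻¹ * ∫⁻ τ in Ioo (c * s') (c * s), g τ := by
  have hpre : (fun σ : ℝ => c * σ) ⁻¹' Ioo (c * s') (c * s) = Ioo s' s := by
    ext σ
    simp only [mem_preimage, mem_Ioo]
    constructor
    · rintro ⟨h1, h2⟩
      exact ⟨lt_of_mul_lt_mul_left h1 hc.le, lt_of_mul_lt_mul_left h2 hc.le⟩
    · rintro ⟨h1, h2⟩
      exact ⟨mul_lt_mul_of_pos_left h1 hc, mul_lt_mul_of_pos_left h2 hc⟩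
  have h1 : ∫⁻ σ in Ioo s' s, g (c * σ) =
      ∫⁻ σ, (Ioo (c * s') (c * s)).indicator g (c * σ) := by
    rw [← lintegral_indicator measurableSet_Ioo, ← hpre]
    rfl
  rw [h1]
  have h2 : ∫⁻ σ, (Ioo (c * s') (c * s)).indicator g (c * σ) =
      ∫⁻ τ, (Ioo (c * s') (c * s)).indicator g τ ∂(Measure.map (fun σ : ℝ => c * σ) volume) := by
    have h := lintegral_map_equiv ((Ioo (c * s') (c * s)).indicator g)
      (Homeomorph.mulLeft₀ c hc.ne').toMeasurableEquiv (μ := (volume : Measure ℝ))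
    have hcoe : ⇑(Homeomorph.mulLeft₀ c hc.ne').toMeasurableEquiv = fun σ : ℝ => c * σ := by
      rw [Homeomorph.toMeasurableEquiv_coe, Homeomorph.coe_mulLeft₀]
    rw [hcoe] at h
    exact h.symm
  rw [h2, Real.map_volume_mul_left hc.ne', lintegral_smul_measure, lintegral_indicator measurableSet_Ioo,
    abs_of_pos (inv_pos.2 hc), smul_eq_mul]

/-- **One zoom keeps (LM_q)**: the zoomed rate `σ ↦ c·b(c²σ)` obeys the log-window bound of `b` on the
correspondingly shrunk windows (scale invariance of `log((−s')/(−s))`). [folklore] -/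
theorem setLIntegral_sq_zoomRate_le {b : ℝ → ℝ} {δ₁ q K₀ c : ℝ} (hc : 0 < c)
    (hLM : ∀ t' t : ℝ, -δ₁ < t' → t' ≤ t → t < 0 →
      ∫⁻ τ in Ioo t' t, ENNReal.ofReal (b τ ^ 2) ≤ ENNReal.ofReal (2 * q * Real.log ((-t') / (-t)) + K₀))
    {s' s : ℝ} (hs' : -(δ₁ / c ^ 2) < s') (hle : s' ≤ s) (hs : s < 0) :
    ∫⁻ σ in Ioo s' s, ENNReal.ofReal (c * b (c ^ 2 * σ)) ^ 2 ≤
      ENNReal.ofReal (2 * q * Real.log ((-s') / (-s)) + K₀) := by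
  have hc2 : 0 < c ^ 2 := pow_pos hc 2
  -- `ofReal(c b)² ≤ ofReal(c²) ofReal(b²)`
  have hpt : ∀ σ : ℝ, ENNReal.ofReal (c * b (c ^ 2 * σ)) ^ 2 ≤
      ENNReal.ofReal (c ^ 2) * ENNReal.ofReal (b (c ^ 2 * σ) ^ 2) := by
    intro σ
    rw [← ENNReal.ofReal_mul hc2.le, ← mul_pow]
    by_cases h : 0 ≤ c * b (c ^ 2 * σ)
    · rw [← ENNReal.ofReal_pow h]
    · rw [not_le] at h
      rw [ENNReal.ofReal_of_nonpos h.le, zero_pow two_ne_zero]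
      exact bot_le
  refine (lintegral_mono fun σ => hpt σ).trans ?_
  rw [lintegral_const_mul' _ _ ENNReal.ofReal_ne_top,
    setLIntegral_Ioo_comp_mul_left (fun τ => ENNReal.ofReal (b τ ^ 2)) hc2, ← mul_assoc,
    ← ENNReal.ofReal_mul hc2.le, mul_inv_cancel₀ hc2.ne', ENNReal.ofReal_one, one_mul]
  -- the shrunk window
  have h1 : -δ₁ < c ^ 2 * s' := by
    have h := mul_lt_mul_of_pos_left hs' hc2
    rwa [mul_neg, mul_div_cancel₀ _ hc2.ne'] at h
  have h2 : c ^ 2 * s' ≤ c ^ 2 * s := mul_le_mul_of_nonneg_left hle hc2.le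
  have h3 : c ^ 2 * s < 0 := mul_neg_of_pos_of_neg hc2 hs
  refine (hLM _ _ h1 h2 h3).trans (le_of_eq ?_)
  congr 2
  rw [neg_mul_eq_mul_neg, neg_mul_eq_mul_neg, mul_div_mul_left _ _ hc2.ne']

/-- **(LM_q) passes to the `liminf` rate of the zooms** (module docstring): Fatou along the scales.
[folklore] -/
theorem setLIntegral_liminfRate_sq_le {b : ℝ → ℝ} (hb : Measurable b) {δ₁ q K₀ : ℝ} (hδ₁ : 0 < δ₁)
    (hLM : ∀ t' t : ℝ, -δ₁ < t' → t' ≤ t → t < 0 →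
      ∫⁻ τ in Ioo t' t, ENNReal.ofReal (b τ ^ 2) ≤ ENNReal.ofReal (2 * q * Real.log ((-t') / (-t)) + K₀))
    {lam : ℕ → ℝ} (hlam : ∀ k, 0 < lam k) (hlam0 : Tendsto lam atTop (𝓝 0))
    {s' s : ℝ} (hle : s' ≤ s) (hs : s < 0) :
    ∫⁻ σ in Ioo s' s, (liminf (fun k => ENNReal.ofReal (lam k * b ((lam k) ^ 2 * σ))) atTop) ^ 2 ≤
      ENNReal.ofReal (2 * q * Real.log ((-s') / (-s)) + K₀) := by
  -- `(liminf B_k)² = liminf (B_k²)` (monotone continuous map on `ℝ≥0∞`)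
  have hsq : ∀ σ : ℝ, (liminf (fun k => ENNReal.ofReal (lam k * b ((lam k) ^ 2 * σ))) atTop) ^ 2 =
      liminf (fun k => ENNReal.ofReal (lam k * b ((lam k) ^ 2 * σ)) ^ 2) atTop := by
    intro σ
    have h := Monotone.map_liminf_of_continuousAt (F := atTop) (f := fun x : ℝ≥0∞ => x ^ 2)
      (fun x y hxy => pow_le_pow_left' hxy 2) (fun k => ENNReal.ofReal (lam k * b ((lam k) ^ 2 * σ)))
      (ENNReal.continuous_pow 2).continuousAt
    exact h
  simp_rw [hsq]
  -- Fatou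
  have hmeas : ∀ k, AEMeasurable (fun σ => ENNReal.ofReal (lam k * b ((lam k) ^ 2 * σ)) ^ 2)
      (volume.restrict (Ioo s' s)) := fun k =>
    ((measurable_const.mul (hb.comp (measurable_const.mul measurable_id))).ennreal_ofReal.pow_const 2)
      |>.aemeasurable
  refine (lintegral_liminf_le' hmeas).trans ?_
  -- eventually every zoom obeys the bound
  have hev : ∀ᶠ k in atTop, ∫⁻ σ in Ioo s' s, ENNReal.ofReal (lam k * b ((lam k) ^ 2 * σ)) ^ 2 ≤
      ENNReal.ofReal (2 * q * Real.log ((-s') / (-s)) + K₀) := by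
    have hpos : 0 < Real.sqrt (δ₁ / (-s' + 1)) := Real.sqrt_pos.2 (div_pos hδ₁ (by linarith))
    filter_upwards [hlam0 (Iio_mem_nhds hpos)] with k hk
    have hμ := hlam k
    refine setLIntegral_sq_zoomRate_le hμ hLM ?_ hle hs
    -- `-(δ₁ / λ²) < s'` from `λ < √(δ₁/(−s'+1))`
    have h1 : (lam k) ^ 2 < δ₁ / (-s' + 1) := by
      have h2 : (lam k) ^ 2 < (Real.sqrt (δ₁ / (-s' + 1))) ^ 2 := pow_lt_pow_left₀ hk hμ.le two_ne_zero
      rwa [Real.sq_sqrt (div_pos hδ₁ (by linarith)).le] at h2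
    rw [lt_div_iff₀ (by linarith : (0 : ℝ) < -s' + 1)] at h1
    rw [neg_lt, lt_div_iff₀ (pow_pos hμ 2)]
    nlinarith [pow_pos hμ 2]
  exact liminf_le_of_frequently_le' (hev.frequently)

end Summit.NavierStokesRegularity.NavierStokesRegularity.Theorems.TypeITraceScarL3

end
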